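import Summits.BirchSwinnertonDyer.BirchSwinnertonDyer.Theorems.ByReductionTypeAtTwoAdditivePotGoodPrintKrizLi44a1
import Summits.BirchSwinnertonDyer.BirchSwinnertonDyer.Theorems.ByReductionTypeAtTwoAdditivePotGoodPrintKrizLi92a1
import HarnessLib

/-!
# K4 crux `AdditiveRankZeroAtTwo` (19098), children C3″ (22617) / C1″ (22615): the Kriz–Li families of `44a1` and `92a1` CLOSED UNDER
# `ℚ`-ISOGENY — `BSD(W′, 2)` at every global minimal `W′` `ℚ`-isogenous to `44a1^{(d)}`, `44a1^{(−7d)}`, `92a1^{(d)}`, `92a1^{(−7d)}`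
# (`d ∈ 𝒩(E, K)`, `χ_d(−N) = 1`), by Cassels' isogeny invariance (Ш finite by GZK in analytic rank `≤ 1`)

Cell `bsd-2adic`, seat `bsd-2adic-k4-w2` GEN 7 (prover, explicit unit, no kit); `--supports stmt-BirchSwinnertonDyer-22617 --as helper`.
HONEST FRAMING (D-0036/D-0054): the NON-CM analogue of the cell `bsd-print-cf2`'s `P2.bsdp_two_of_isIsogenous_twist_of_krizLi_cmBase`:
§1 generic (base of conductor `< 5000`, both bases by Creutz–Miller, (★)-datum displayed), §2 BY NAME at `44a1` and `92a1` from the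
Table-2 rows (`KrizLi2019.table2_row44a1/_row92a1`). Inputs BY NAME: Kriz–Li Thm 5.1 (2) (`hKL`), Thm 4.3 (`h33`), Creutz–Miller (`hS31`),
Agashe–Ribet–Stein (`h26`, at the instances), Cassels' isogeny invariance of the BSD quotient (`hCassels`, tree `Wuthrich2014.bsdp_of_isIsogenous`),
GZK (`hGZK`, finiteness of Ш of the family member) and modularity (`hmod`, `L^{(r)}(1) ≠ 0`). The K4 items quantify over ALL global minimal
curves, so the isogenous curves (e.g. the twists of `44a2 = [0,1,0,−77,−289]`, `3`-isogenous to `44a1`, and of `92a2`) are further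
instances. Closes nothing at the `∀`-level; nothing booked; BSD is not proved by any of this.

References: [KrizLi2019] Thm 5.1 (2), Thm 4.3, §6 Table 2; [CreutzMiller2012] Thm 1.1; [MilneADT2006] Thm I.7.3; [Cassels1965ArithmeticVIII];
[Miller2011LMS] Def 1.1; [CremonaAlgorithms1997] Table 1 (classes 44A, 92A).
-/

set_option autoImplicit false
-- the Theorems namespace of this sub repeats the summit name by design (D-0017 nested layout)
set_option linter.dupNamespace false

noncomputable section

open scoped Classical

open WeierstrassCurve NumberField Literature.NumberTheory.EllipticCurves
  Literature.NumberTheory.EllipticCurves.ModularForms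
  Literature.NumberTheory.EllipticCurves.Rank1Residual
  Literature.NumberTheory.EllipticCurves.Rank1Residual.Typed
  Literature.NumberTheory.EllipticCurves.AgasheRibetStein2006
  Summit.BirchSwinnertonDyer.Rank1Residual
  Summit.BirchSwinnertonDyer.Rank1Residual.P2

namespace Summit.BirchSwinnertonDyer.BirchSwinnertonDyer.Theorems.AddPotGoodPrint

/-! ## §1 Generic: the Kriz–Li family of a non-CM small-conductor base, closed under `ℚ`-isogeny -/
section Generic

variable (V : WeierstrassCurve ℚ) [V.IsElliptic] [V.IsGloballyMinimal] [NeZero (V.conductorNorm ℤ)]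

/-- **`BSD(W′, 2)` for every global minimal `W′` `ℚ`-ISOGENOUS to `V^{(d)}` or to `V^{(d·d_K)}`** (`d ∈ 𝒩(V, K)`, `χ_d(−N) = 1`), in the
setting of `krizLi_bsdp_two_of_twist_of_conductor_lt` (base of conductor `< 5000`, partner model `W₀` of conductor `< 5000`, `V(ℚ)[2] = 0`,
Heegner field `K`, (★)-datum, `hloc`): the twist theorem on a global minimal model (analytic rank `≤ 1` by Thm 4.3), then Cassels'
isogeny invariance (`hCassels`; `Ш` finite by `hGZK`, `L^{(r)}(1) ≠ 0` by `hmod`). BSD is not proved by any of this.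
[cite: KrizLi2019, Thm. 5.1 (2) and Thm. 4.3] [cite: MilneADT2006, Thm. I.7.3] [cite: CreutzMiller2012, Thm. 1.1] [cite: Miller2011LMS, Def. 1.1] -/
theorem krizLi_bsdp_two_of_isIsogenous_twist_of_conductor_lt (hKL : KrizLi2019.thm112_bsdTwo_twist) (h33 : KrizLi2019.thm33_rank_twist)
    (hS31 : bsdTriple_of_analyticRank_le_one_of_conductor_lt) (hCassels : bsdRHS_eq_of_isIsogenous)
    (hGZK : rank_eq_analyticRank_of_analyticRank_le_one) (hmod : hasEntireLFunction_rat)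
    (hN : V.conductorNorm ℤ < 5000) (h2 : ∀ Q : V.toAffine.Point, 2 • Q = 0 → Q = 0)
    (K : Type) [Field K] [NumberField K] (hK : IsImaginaryQuadratic K) (hH : SatisfiesHeegnerHypothesis (V.conductorNorm ℤ) K)
    (Dt : ModularParametrizationData V (V.conductorNorm ℤ)) (H : HeegnerDatum (V.conductorNorm ℤ) (NumberField.discr K))
    (ι : K →+* ℂ) (P : (V.baseChange K).toAffine.Point) (hP : WeierstrassCurve.Affine.Point.map ι.toRatAlgHom P = heegnerPointComplex Dt H)
    (j : K →ₐ[ℚ] ℚ_[2]) (hstar : KrizLi2019.AssumptionStar V Dt K P j)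
    (hloc : (haveI : Fact (2 : ℕ).Prime := ⟨Nat.prime_two⟩;
      Odd ((V.baseChange ℚ_[2]).localTamagawaNumber ℤ_[2]) ∧
        (¬ V.HasGoodReductionAtPrime 2 → ¬ V.HasMultiplicativeReductionAtPrime 2 → Odd Dt.c)))
    (W₀ : WeierstrassCurve ℚ) [W₀.IsElliptic] [W₀.IsGloballyMinimal]
    (hW₀ : ∃ C : VariableChange ℚ, C • V.quadraticTwist (NumberField.discr K : ℚ) = W₀) (hN₀ : W₀.conductorNorm ℤ < 5000)
    {d : ℤ} (hd : KrizLi2019.InN V K d) (hsign : Int.sign d * jacobiSym (V.conductorNorm ℤ) d.natAbs = 1)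
    (W' : WeierstrassCurve ℚ) [W'.IsElliptic] [W'.IsGloballyMinimal]
    (hiso : (haveI := V.isElliptic_quadraticTwist (cast_ne_zero_of_inN V hd); IsIsogenous W' (V.quadraticTwist (d : ℚ))) ∨
      (haveI := V.isElliptic_quadraticTwist (show ((d * NumberField.discr K : ℤ) : ℚ) ≠ 0 by
          push_cast; exact mul_ne_zero (cast_ne_zero_of_inN V hd) (by exact_mod_cast NumberField.discr_ne_zero K));
        IsIsogenous W' (V.quadraticTwist ((d * NumberField.discr K : ℤ) : ℚ)))) :
    BSDp W' 2 := by
  have hD : (NumberField.discr K : ℚ) ≠ 0 := by exact_mod_cast NumberField.discr_ne_zero K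
  have hd0 : (d : ℚ) ≠ 0 := cast_ne_zero_of_inN V hd
  have hdK : ((d * NumberField.discr K : ℤ) : ℚ) ≠ 0 := by push_cast; exact mul_ne_zero hd0 hD
  haveI := V.isElliptic_quadraticTwist hd0
  haveI := V.isElliptic_quadraticTwist hdK
  obtain ⟨W₁, _, _, C₁, hC₁⟩ := exists_globallyMinimal_twist V hd0
  obtain ⟨W₂, _, _, C₂, hC₂⟩ := exists_globallyMinimal_twist V hdK
  obtain ⟨hor, -⟩ := krizLi_analyticRank_twists V h33 h2 K hK hH Dt H ι P hP j hstar hd hsign W₁ W₂ ⟨C₁, hC₁⟩ ⟨C₂, hC₂⟩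
  rcases hiso with hiso | hiso
  · have hiso' : IsIsogenous W' W₁ := hiso.trans' (by rw [← hC₁]; exact isIsogenous_smul _ C₁)
    have hbsd := krizLi_bsdp_two_of_twist_of_conductor_lt V hKL h33 hS31 hN h2 K hK hH Dt H ι P hP j hstar hloc W₀ hW₀ hN₀ hd hsign
      W₁ (Or.inl ⟨C₁, hC₁⟩)
    exact Wuthrich2014.bsdp_of_isIsogenous hCassels hiso' (hGZK W₁ (by omega)).2 (W₁.leadingLCoeff_ne_zero_holds (hmod W₁)) hbsd
  · have hiso' : IsIsogenous W' W₂ := hiso.trans' (by rw [← hC₂]; exact isIsogenous_smul _ C₂)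
    have hbsd := krizLi_bsdp_two_of_twist_of_conductor_lt V hKL h33 hS31 hN h2 K hK hH Dt H ι P hP j hstar hloc W₀ hW₀ hN₀ hd hsign
      W₂ (Or.inr ⟨C₂, hC₂⟩)
    exact Wuthrich2014.bsdp_of_isIsogenous hCassels hiso' (hGZK W₂ (by omega)).2 (W₂.leadingLCoeff_ne_zero_holds (hmod W₂)) hbsd

end Generic

/-! ## §2 At `44a1` and `92a1`, BY NAME from the Table-2 rows -/
section Instances

/-- **`BSD(W′, 2)` for every global minimal `W′` `ℚ`-isogenous to `44a1^{(d)}` or `44a1^{(−7d)}`** (`K` any quadratic field with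
`d_K = −7`, `d ∈ 𝒩(44a1, K)`, `χ_d(−44) = 1`), BY NAME from Kriz–Li Thm 5.1 (2) / 4.3, the Table-2 row `44a1`, Creutz–Miller, ARS, Cassels,
GZK, modularity. BSD is not proved by any of this. [cite: KrizLi2019, Thm. 5.1 (2), Thm. 4.3, §6 Table 2 (row 44a1)] [cite: MilneADT2006, Thm. I.7.3]
[cite: CreutzMiller2012, Thm. 1.1] [cite: AgasheRibetStein2006, Thm. 2.6] [cite: Miller2011LMS, Def. 1.1] -/
theorem krizLi_bsdp_two_of_isIsogenous_twist_44A1 (hKL : KrizLi2019.thm112_bsdTwo_twist) (h33 : KrizLi2019.thm33_rank_twist)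
    (htab : KrizLi2019.table2_row44a1) (hS31 : bsdTriple_of_analyticRank_le_one_of_conductor_lt)
    (h26 : cremona_abs_maninConstant_eq_one_of_level_le) (hCassels : bsdRHS_eq_of_isIsogenous)
    (hGZK : rank_eq_analyticRank_of_analyticRank_le_one) (hmod : hasEntireLFunction_rat)
    (K : Type) [Field K] [NumberField K] (hK : IsImaginaryQuadratic K) (hdK : NumberField.discr K = -7)
    {d : ℤ} (hd : haveI := isGloballyMinimal_44A1; KrizLi2019.InN (⟨0, 1, 0, 3, -1⟩ : WeierstrassCurve ℚ) K d)
    (hsign : haveI := isElliptic_44A1; Int.sign d * jacobiSym ((⟨0, 1, 0, 3, -1⟩ : WeierstrassCurve ℚ).conductorNorm ℤ) d.natAbs = 1)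
    (W' : WeierstrassCurve ℚ) [W'.IsElliptic] [W'.IsGloballyMinimal]
    (hiso : (haveI := isElliptic_44A1; haveI := isGloballyMinimal_44A1;
        haveI := (⟨0, 1, 0, 3, -1⟩ : WeierstrassCurve ℚ).isElliptic_quadraticTwist (cast_ne_zero_of_inN _ hd);
        IsIsogenous W' ((⟨0, 1, 0, 3, -1⟩ : WeierstrassCurve ℚ).quadraticTwist (d : ℚ))) ∨
      (haveI := isElliptic_44A1; haveI := isGloballyMinimal_44A1;
        haveI := (⟨0, 1, 0, 3, -1⟩ : WeierstrassCurve ℚ).isElliptic_quadraticTwist (show ((-7 * d : ℤ) : ℚ) ≠ 0 by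
          push_cast; exact mul_ne_zero (by norm_num) (cast_ne_zero_of_inN _ hd));
        IsIsogenous W' ((⟨0, 1, 0, 3, -1⟩ : WeierstrassCurve ℚ).quadraticTwist ((-7 * d : ℤ) : ℚ)))) :
    BSDp W' 2 := by
  haveI := isElliptic_44A1; haveI := isGloballyMinimal_44A1
  haveI := isElliptic_T44A1; haveI := isGloballyMinimal_T44A1
  obtain ⟨_, Dt, H, ι, P, j, hopt, hP, hstar⟩ := htab K hK hdK
  have hdK' : ((d * NumberField.discr K : ℤ) : ℚ) = ((-7 * d : ℤ) : ℚ) := by rw [hdK]; push_cast; ring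
  refine krizLi_bsdp_two_of_isIsogenous_twist_of_conductor_lt _ hKL h33 hS31 hCassels hGZK hmod conductorNorm_lt_5000_44A1
    twoTorsion_44A1 K hK (satisfiesHeegnerHypothesis_44A1 hK.1 hdK) Dt H ι P hP j hstar (krizLi_loc_44A1 h26 Dt hopt)
    (⟨0, -7, 0, 147, 343⟩ : WeierstrassCurve ℚ) (partner_44A1 hdK) conductorNorm_lt_5000_T44A1 hd hsign W' ?_
  rcases hiso with h | h
  · exact Or.inl h
  · right; rw [hdK']; exact h

/-- **`BSD(W′, 2)` for every global minimal `W′` `ℚ`-isogenous to `92a1^{(d)}` or `92a1^{(−7d)}`** (`d_K = −7`, `d ∈ 𝒩(92a1, K)`,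
`χ_d(−92) = 1`), BY NAME. BSD is not proved by any of this. [cite: KrizLi2019, Thm. 5.1 (2), Thm. 4.3, §6 Table 2 (row 92a1)]
[cite: MilneADT2006, Thm. I.7.3] [cite: CreutzMiller2012, Thm. 1.1] [cite: AgasheRibetStein2006, Thm. 2.6] [cite: Miller2011LMS, Def. 1.1] -/
theorem krizLi_bsdp_two_of_isIsogenous_twist_92A1 (hKL : KrizLi2019.thm112_bsdTwo_twist) (h33 : KrizLi2019.thm33_rank_twist)
    (htab : KrizLi2019.table2_row92a1) (hS31 : bsdTriple_of_analyticRank_le_one_of_conductor_lt)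
    (h26 : cremona_abs_maninConstant_eq_one_of_level_le) (hCassels : bsdRHS_eq_of_isIsogenous)
    (hGZK : rank_eq_analyticRank_of_analyticRank_le_one) (hmod : hasEntireLFunction_rat)
    (K : Type) [Field K] [NumberField K] (hK : IsImaginaryQuadratic K) (hdK : NumberField.discr K = -7)
    {d : ℤ} (hd : haveI := isGloballyMinimal_92A1; KrizLi2019.InN (⟨0, 1, 0, 2, 1⟩ : WeierstrassCurve ℚ) K d)
    (hsign : haveI := isElliptic_92A1; Int.sign d * jacobiSym ((⟨0, 1, 0, 2, 1⟩ : WeierstrassCurve ℚ).conductorNorm ℤ) d.natAbs = 1)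
    (W' : WeierstrassCurve ℚ) [W'.IsElliptic] [W'.IsGloballyMinimal]
    (hiso : (haveI := isElliptic_92A1; haveI := isGloballyMinimal_92A1;
        haveI := (⟨0, 1, 0, 2, 1⟩ : WeierstrassCurve ℚ).isElliptic_quadraticTwist (cast_ne_zero_of_inN _ hd);
        IsIsogenous W' ((⟨0, 1, 0, 2, 1⟩ : WeierstrassCurve ℚ).quadraticTwist (d : ℚ))) ∨
      (haveI := isElliptic_92A1; haveI := isGloballyMinimal_92A1;
        haveI := (⟨0, 1, 0, 2, 1⟩ : WeierstrassCurve ℚ).isElliptic_quadraticTwist (show ((-7 * d : ℤ) : ℚ) ≠ 0 by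
          push_cast; exact mul_ne_zero (by norm_num) (cast_ne_zero_of_inN _ hd));
        IsIsogenous W' ((⟨0, 1, 0, 2, 1⟩ : WeierstrassCurve ℚ).quadraticTwist ((-7 * d : ℤ) : ℚ)))) :
    BSDp W' 2 := by
  haveI := isElliptic_92A1; haveI := isGloballyMinimal_92A1
  haveI := isElliptic_T92A1; haveI := isGloballyMinimal_T92A1
  obtain ⟨_, Dt, H, ι, P, j, hopt, hP, hstar⟩ := htab K hK hdK
  have hdK' : ((d * NumberField.discr K : ℤ) : ℚ) = ((-7 * d : ℤ) : ℚ) := by rw [hdK]; push_cast; ring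
  refine krizLi_bsdp_two_of_isIsogenous_twist_of_conductor_lt _ hKL h33 hS31 hCassels hGZK hmod conductorNorm_lt_5000_92A1
    twoTorsion_92A1 K hK (satisfiesHeegnerHypothesis_92A1 hK.1 hdK) Dt H ι P hP j hstar (krizLi_loc_92A1 h26 Dt hopt)
    (⟨0, -7, 0, 98, -343⟩ : WeierstrassCurve ℚ) (partner_92A1 hdK) conductorNorm_lt_5000_T92A1 hd hsign W' ?_
  rcases hiso with h | h
  · exact Or.inl h
  · right; rw [hdK']; exact h

end Instances

end Summit.BirchSwinnertonDyer.BirchSwinnertonDyer.Theorems.AddPotGoodPrint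

end
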